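import Summits.QuantumFields.GaugeBoot.DiagonalRPTorusRestJet
import HarnessLib

/-!
# The jet of a truncated rest correlation is decided by the small joining clusters
(gauge-boot, L3 `d = 3` uniform window, brick 6b)

HONEST FRAMING (cell `pub-gaugeboot`, page 1 of every file): the venture produces certified bounds
on lattice expectations at stated coupling, gauge group, dimension and torus size; NOT a mass gap,
NOT a continuum limit, NOT a string tension; NOT Yang–Mills-summit-bearing (barriers
`FixedCouplingUltralocality`, `PerturbativeInvisibility`). This module is the interface between the
analytic half (`DiagonalRPTorusRestJet`: a jet of the near-pair truncated correlation gives a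
uniform window) and the combinatorial crux of the `d = 3` leg (evaluate finitely many cluster
integrals); it proves no window and evaluates no cluster.

## Content (torus `(ℤ/L)^d`, compact metrisable `G`, continuous `ρ`)

* `replicaTerm f g Q z` — the REPLICA CLUSTER INTEGRAL of a finite set `Q` of plaquettes:
  `∫ (f(U) - f(U')) (g(U) - g(U')) ∏_{q ∈ Q} ((1 + f_q^z(U))(1 + f_q^z(U')) - 1) dU dU'` on the
  doubled Haar product (Literature `PlaqSystem.dblWeightProd`, `dblHaar`), read on the torus
  through `torusSigma`; `norm_replicaTerm_le`: it is `O(z^{#Q})` with an explicit constant.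
* `joins_image_tlab_iff` — the torus system's `Joins` on `Q.image tlab` is `TJoins Q`.
* ★ **`restTruncC_mul_partZ_sq_eq`** — the Literature replica formula
  (`PlaqSystem.partZ_mul_numZ_sub_eq_sum`) through the dictionary:
  `κ_V(z) · Z_V(z)² = ½ Σ_{Q ⊆ V, Q joins E₁ to E₂} replicaTerm Q z`.
* ★★ **`restTruncC_jet_of_smallClusters`** — if the SMALL joining clusters carry the jet,
  `½ Σ_{Q ⊆ V, TJoins Q E₁ E₂, #Q ≤ m} replicaTerm Q z - c z^m = O(z^{m+1})` at `z = 0`, then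
  `restTruncC V f g z - c z^m = O(z^{m+1})` — the hypothesis of
  `DiagRPUnif.restTrunc_ge_of_jet` / `trickForm_sub_translate_neg_of_jet`. (The large clusters are
  `O(z^{m+1})` termwise and finitely many at fixed `L`; `Z_V(0) = 1`.)

So the `d = 3` uniform window is reduced to a FINITE COMPUTATION at each fixed `L ≥ L₀`: the
`z`-jets to order `10` of the replica cluster integrals of the joining sets of at most `10` rest
plaquettes around the two bent hexagons, with an `L`-independent leading coefficient
(plan note `HOME/pub-gaugeboot-lean3/gen46/D3-UNIFORM-PLAN.md` §3). Elementary given the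
Literature layer; no named fact.
-/

open MeasureTheory Finset Function Filter Asymptotics
open scoped Topology

namespace Summit.QuantumFields.GaugeBoot

open Literature.MathematicalPhysics.QuantumFieldTheory

noncomputable section

namespace DiagRPUnif

open DiagRPTube

variable {d L : ℕ} [NeZero L] {N : ℕ} {G : Type*} [Group G] [TopologicalSpace G]
  [IsTopologicalGroup G] [CompactSpace G] [MeasurableSpace G] [BorelSpace G]
  (ρ : G →* Matrix (Fin N) (Fin N) ℂ)

/-! ## Replica cluster integrals -/

/-- The REPLICA CLUSTER INTEGRAL of the plaquette set `Q` for the observables `f`, `g` at complex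
coupling `z`: `∫ (f(U)-f(U'))(g(U)-g(U')) ∏_{q ∈ Q} ((1+f_q(U))(1+f_q(U'))-1) dU dU'`. -/
def replicaTerm (f g : GaugeConfig d L G → ℝ) (Q : Finset (Plaquette d L)) (z : ℂ) : ℂ :=
  ∫ W, ((((f (torusSigma L W.fst) : ℝ) : ℂ) - f (torusSigma L W.snd)) *
      (((g (torusSigma L W.fst) : ℝ) : ℂ) - g (torusSigma L W.snd)) *
        (torusSystem ρ L).dblWeightProd z (Q.image tlab) W) ∂dblHaar d G

omit [NeZero L] in
/-- **Each replica cluster integral is `O(z^{#Q})`**: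
`‖replicaTerm Q z‖ ≤ 4 C_f C_g (8 M ‖z‖)^{#Q}` for `‖z‖ M ≤ 1`, `M = costBound ρ`. -/
theorem norm_replicaTerm_le [NeZero L] (hρ : Continuous ρ) {f g : GaugeConfig d L G → ℝ}
    {Cf Cg : ℝ} (hfb : ∀ U, |f U| ≤ Cf) (hgb : ∀ U, |g U| ≤ Cg) (Q : Finset (Plaquette d L))
    {z : ℂ} (hz : ‖z‖ * costBound ρ ≤ 1) :
    ‖replicaTerm ρ f g Q z‖ ≤ 4 * Cf * Cg * (8 * costBound ρ * ‖z‖) ^ Q.card := by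
  have h := PlaqSystem.norm_integral_trunc_dblWeightProd_le
    (torusSystem_regular (d := d) ρ hρ (L := L)) hz
    (F₁ := fun U => ((f (torusSigma L U) : ℝ) : ℂ)) (F₂ := fun U => ((g (torusSigma L U) : ℝ) : ℂ))
    (fun U => by rw [Complex.norm_real, Real.norm_eq_abs]; exact hfb _)
    (fun U => by rw [Complex.norm_real, Real.norm_eq_abs]; exact hgb _) (Q.image tlab)
  rw [card_image_of_injective _ tlab_injective] at h
  exact h

/-! ## Joining: the two-sided transfer -/

omit [NeZero L] [TopologicalSpace G] [IsTopologicalGroup G] [CompactSpace G] [MeasurableSpace G]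
  [BorelSpace G] in
/-- **`Joins (Q.image tlab) ↔ TJoins Q`** for the sectioned supports. -/
theorem joins_image_tlab_iff [NeZero L] (Q : Finset (Plaquette d L)) (E₁ E₂ : Finset (Edge d L)) :
    (torusSystem (G := G) ρ L).Joins (Q.image tlab) (E₁.image (torusSect L))
        (E₂.image (torusSect L)) ↔ TJoins Q E₁ E₂ := by
  constructor
  · intro hJ
    obtain ⟨Q', hQ', -, hTJ⟩ := tjoins_of_joins (G := G) ρ (V := Q) subset_rfl hJ
    -- `tjoins_of_joins` produces a subset of `Q` that joins; joining is monotone in the set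
    obtain ⟨p, hp, q, hq, htp, htq, hreach⟩ := hTJ
    exact ⟨p, hQ' hp, q, hQ' hq, htp, htq, hreach.mono hQ'⟩
  · rintro ⟨p, hp, q, hq, htp, htq, hreach⟩
    -- transfer of the chain along `tlab`
    have key : ∀ z, Polymer.Reach padj Q p z →
        Polymer.Reach (torusSystem (G := G) ρ L).Adj (Q.image tlab) (tlab p) (tlab z) := by
      intro z hz
      induction hz with
      | refl => exact Polymer.Reach.refl _
      | @tail b c _ hbc ih =>
        obtain ⟨hbQ, hcQ, hadj⟩ := hbc
        exact ih.tail (mem_image_of_mem _ hbQ) (mem_image_of_mem _ hcQ)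
          ((adj_tlab_iff ρ b c).2 hadj)
    exact ⟨tlab p, mem_image_of_mem _ hp, tlab q, mem_image_of_mem _ hq,
      (touches_tlab_iff ρ E₁ p).2 htp, (touches_tlab_iff ρ E₂ q).2 htq, key q hreach⟩

/-! ## The replica formula through the dictionary -/

section Replica

open Classical in
/-- ★ **The replica formula**: `κ_V(z) Z_V(z)² = ½ Σ_{Q ⊆ V joining} replicaTerm Q z`
(whenever `Z_V(z) ≠ 0`). -/
theorem restTruncC_mul_partZ_sq_eq (hρ : Continuous ρ) (V : Finset (Plaquette d L))
    {f g : GaugeConfig d L G → ℝ} (hfm : Measurable f) (hgm : Measurable g) {Cf Cg : ℝ}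
    (hfb : ∀ U, |f U| ≤ Cf) (hgb : ∀ U, |g U| ≤ Cg) {E₁ E₂ : Finset (Edge d L)}
    (hfE : DependsOn f (E₁ : Set (Edge d L))) (hgE : DependsOn g (E₂ : Set (Edge d L)))
    (hE : Disjoint E₁ E₂) {z : ℂ} (hZ : (torusSystem ρ L).partZ (V.image tlab) z ≠ 0) :
    restTruncC ρ V f g z * (torusSystem ρ L).partZ (V.image tlab) z ^ 2 =
      (1 / 2 : ℂ) * ∑ Q ∈ V.powerset.filter (fun Q => TJoins Q E₁ E₂), replicaTerm ρ f g Q z := by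
  classical
  have h1m : Measurable fun U : ZdGaugeConfig d G => ((f (torusSigma L U) : ℝ) : ℂ) :=
    Complex.measurable_ofReal.comp (hfm.comp (measurable_torusSigma L))
  have h2m : Measurable fun U : ZdGaugeConfig d G => ((g (torusSigma L U) : ℝ) : ℂ) :=
    Complex.measurable_ofReal.comp (hgm.comp (measurable_torusSigma L))
  have h1b : ∀ U : ZdGaugeConfig d G, ‖((f (torusSigma L U) : ℝ) : ℂ)‖ ≤ Cf := fun U => by
    rw [Complex.norm_real, Real.norm_eq_abs]; exact hfb _
  have h2b : ∀ U : ZdGaugeConfig d G, ‖((g (torusSigma L U) : ℝ) : ℂ)‖ ≤ Cg := fun U => by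
    rw [Complex.norm_real, Real.norm_eq_abs]; exact hgb _
  have h1d := dependsOn_comp_torusSigma (f := fun W => ((f W : ℝ) : ℂ)) (E := E₁)
    (fun U U' h => by show ((f U : ℝ) : ℂ) = f U'; rw [hfE h])
  have h2d := dependsOn_comp_torusSigma (f := fun W => ((g W : ℝ) : ℂ)) (E := E₂)
    (fun U U' h => by show ((g U : ℝ) : ℂ) = g U'; rw [hgE h])
  have hB : Disjoint (E₁.image (torusSect L)) (E₂.image (torusSect L)) := by
    rw [disjoint_image (torusSect_injective (L := L))]; exact hE
  have hrep := PlaqSystem.partZ_mul_numZ_sub_eq_sum (torusSystem_regular (d := d) ρ hρ (L := L))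
    h1m h2m h1b h2b h1d h2d hB (V.image tlab) z
  -- left-hand side: `κ Z² = Z N₁₂ − N₁ N₂`
  have hlhs : restTruncC ρ V f g z * (torusSystem ρ L).partZ (V.image tlab) z ^ 2 =
      (torusSystem ρ L).partZ (V.image tlab) z *
          (torusSystem ρ L).numZ (fun U => ((f (torusSigma L U) : ℝ) : ℂ) *
            ((g (torusSigma L U) : ℝ) : ℂ)) (V.image tlab) z -
        (torusSystem ρ L).numZ (fun U => ((f (torusSigma L U) : ℝ) : ℂ)) (V.image tlab) z *
          (torusSystem ρ L).numZ (fun U => ((g (torusSigma L U) : ℝ) : ℂ)) (V.image tlab) z := by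
    rw [restTruncC, PlaqSystem.expect_mul_sub_eq_div _ hZ]
    field_simp
  rw [hlhs, hrep]
  congr 1
  -- reindex the joining label sets by `Q ↦ Q.image tlab`
  symm
  refine Finset.sum_nbij (fun Q : Finset (Plaquette d L) => Q.image tlab) ?_ ?_ ?_ (fun _ _ => rfl)
  · intro Q hQ
    rw [mem_filter, mem_powerset] at hQ ⊢
    exact ⟨image_subset_image hQ.1, (joins_image_tlab_iff ρ Q E₁ E₂).2 hQ.2⟩
  · exact fun Q _ Q' _ h => (image_injective tlab_injective) h
  · intro Q' hQ'
    rw [mem_coe, mem_filter, mem_powerset] at hQ'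
    obtain ⟨hQ'V, hJ⟩ := hQ'
    have himg : (V.filter fun q => tlab q ∈ Q').image tlab = Q' := by
      ext x
      simp only [mem_image, mem_filter]
      constructor
      · rintro ⟨q, ⟨-, hq⟩, rfl⟩; exact hq
      · intro hx
        obtain ⟨q, hqV, rfl⟩ := mem_image.1 (hQ'V hx)
        exact ⟨q, ⟨hqV, hx⟩, rfl⟩
    refine ⟨V.filter fun q => tlab q ∈ Q', ?_, himg⟩
    rw [mem_coe, mem_filter, mem_powerset]
    refine ⟨filter_subset _ _, ?_⟩
    rw [← joins_image_tlab_iff ρ, himg]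
    exact hJ

open Classical in
/-- ★★ **THE JET IS DECIDED BY THE SMALL JOINING CLUSTERS.** If
`½ Σ_{Q ⊆ V, TJoins Q E₁ E₂, #Q ≤ m} replicaTerm Q z - c z^m = O(z^{m+1})` at `z = 0`, then
`restTruncC V f g z - c z^m = O(z^{m+1})`: the hypothesis of `restTrunc_ge_of_jet` /
`trickForm_sub_translate_neg_of_jet`. -/
theorem restTruncC_jet_of_smallClusters (hρ : Continuous ρ) (V : Finset (Plaquette d L))
    {f g : GaugeConfig d L G → ℝ} (hfm : Measurable f) (hgm : Measurable g) {Cf Cg : ℝ}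
    (hfb : ∀ U, |f U| ≤ Cf) (hgb : ∀ U, |g U| ≤ Cg) {E₁ E₂ : Finset (Edge d L)}
    (hfE : DependsOn f (E₁ : Set (Edge d L))) (hgE : DependsOn g (E₂ : Set (Edge d L)))
    (hE : Disjoint E₁ E₂) {m : ℕ} {c : ℂ}
    (hsmall : (fun z => (1 / 2 : ℂ) *
        ∑ Q ∈ V.powerset.filter (fun Q => TJoins Q E₁ E₂ ∧ Q.card ≤ m), replicaTerm ρ f g Q z -
          c * z ^ m) =O[𝓝 (0 : ℂ)] fun z => z ^ (m + 1)) :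
    (fun z => restTruncC ρ V f g z - c * z ^ m) =O[𝓝 (0 : ℂ)] fun z => z ^ (m + 1) := by
  classical
  set S := torusSystem (G := G) ρ L with hS
  set M : ℝ := costBound ρ with hM
  have hMpos : 0 < M := costBound_pos ρ
  have hR := torusSystem_regular (d := d) ρ hρ (L := L)
  have hCf : 0 ≤ Cf := (abs_nonneg _).trans (hfb 1)
  have hCg : 0 ≤ Cg := (abs_nonneg _).trans (hgb 1)
  -- near `0`: the partition function is close to `1`, the coupling is small
  have hcont : ContinuousAt (S.partZ (V.image tlab)) 0 :=
    (PlaqSystem.differentiable_partZ hR (V.image tlab) 0).continuousAt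
  have hZnear : ∀ᶠ z in 𝓝 (0 : ℂ), 1 / 2 ≤ ‖S.partZ (V.image tlab) z‖ := by
    have h := (Metric.tendsto_nhds.1 hcont) (1 / 2) (by norm_num)
    filter_upwards [h] with z hz
    rw [PlaqSystem.partZ_zero, dist_eq_norm] at hz
    have h1 : ‖(1 : ℂ)‖ - ‖S.partZ (V.image tlab) z‖ ≤ ‖1 - S.partZ (V.image tlab) z‖ :=
      norm_sub_norm_le _ _
    rw [norm_one, norm_sub_rev] at h1
    linarith
  have hsmallz : ∀ᶠ z in 𝓝 (0 : ℂ), 8 * M * ‖z‖ ≤ 1 := by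
    have h : Metric.ball (0 : ℂ) (1 / (8 * M)) ∈ 𝓝 (0 : ℂ) := Metric.ball_mem_nhds 0 (by positivity)
    filter_upwards [h] with z hz
    rw [Metric.mem_ball, dist_zero_right] at hz
    have := (lt_div_iff₀ (by positivity : (0 : ℝ) < 8 * M)).1 hz
    linarith
  -- the LARGE clusters are `O(z^{m+1})`
  set Tl := V.powerset.filter (fun Q => TJoins Q E₁ E₂ ∧ ¬ Q.card ≤ m) with hTl
  have hlarge : (fun z => (1 / 2 : ℂ) * ∑ Q ∈ Tl, replicaTerm ρ f g Q z)
      =O[𝓝 (0 : ℂ)] fun z => z ^ (m + 1) := by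
    refine IsBigO.of_bound (1 / 2 * ∑ Q ∈ Tl, 4 * Cf * Cg * (8 * M) ^ Q.card) ?_
    filter_upwards [hsmallz] with z hz8
    have hz1 : ‖z‖ * costBound ρ ≤ 1 := by rw [← hM]; nlinarith [norm_nonneg z]
    rw [norm_mul, norm_pow, show ‖(1 / 2 : ℂ)‖ = 1 / 2 by norm_num, mul_assoc, sum_mul]
    refine mul_le_mul_of_nonneg_left ((norm_sum_le _ _).trans (sum_le_sum fun Q hQ => ?_))
      (by norm_num)
    have hcard : m + 1 ≤ Q.card := by
      have := (mem_filter.1 hQ).2.2; omega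
    refine (norm_replicaTerm_le ρ hρ hfb hgb Q hz1).trans ?_
    rw [← hM, mul_pow, mul_assoc (4 * Cf * Cg)]
    refine mul_le_mul_of_nonneg_left ?_ (mul_nonneg (mul_nonneg (by norm_num) hCf) hCg)
    refine mul_le_mul_of_nonneg_left ?_ (pow_nonneg (mul_nonneg (by norm_num) hMpos.le) _)
    -- `‖z‖^{#Q} ≤ ‖z‖^{m+1}` since `‖z‖ ≤ 1/(8M) ≤ 1`
    have hz_le_one : ‖z‖ ≤ 1 := by nlinarith [one_le_costBound ρ, norm_nonneg z]
    calc ‖z‖ ^ Q.card = ‖z‖ ^ (m + 1) * ‖z‖ ^ (Q.card - (m + 1)) := by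
          rw [← pow_add, Nat.add_sub_cancel' hcard]
      _ ≤ ‖z‖ ^ (m + 1) * 1 :=
          mul_le_mul_of_nonneg_left (pow_le_one₀ (norm_nonneg _) hz_le_one) (by positivity)
      _ = ‖z‖ ^ (m + 1) := mul_one _
  -- the replica formula splits into small and large clusters
  have hsplit : ∀ z, (1 / 2 : ℂ) * ∑ Q ∈ V.powerset.filter (fun Q => TJoins Q E₁ E₂),
      replicaTerm ρ f g Q z =
      (1 / 2 : ℂ) * ∑ Q ∈ V.powerset.filter (fun Q => TJoins Q E₁ E₂ ∧ Q.card ≤ m),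
          replicaTerm ρ f g Q z + (1 / 2 : ℂ) * ∑ Q ∈ Tl, replicaTerm ρ f g Q z := by
    intro z
    rw [← mul_add, ← sum_filter_add_sum_filter_not (V.powerset.filter fun Q => TJoins Q E₁ E₂)
      (fun Q => Q.card ≤ m), filter_filter, filter_filter]
  -- `P(z) - c z^m = O(z^{m+1})` for `P = κ Z²`
  have hP : (fun z => (1 / 2 : ℂ) * ∑ Q ∈ V.powerset.filter (fun Q => TJoins Q E₁ E₂),
      replicaTerm ρ f g Q z - c * z ^ m) =O[𝓝 (0 : ℂ)] fun z => z ^ (m + 1) := by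
    have h := hsmall.add hlarge
    refine h.congr' (Eventually.of_forall fun z => ?_) EventuallyEq.rfl
    simp only [hsplit z]
    ring
  -- `1 - Z² = O(z)` and `Z⁻² = O(1)` near `0`
  have hZdiff : DifferentiableAt ℂ (fun z => S.partZ (V.image tlab) z ^ 2) 0 :=
    (PlaqSystem.differentiable_partZ hR (V.image tlab) 0).pow 2
  have hZsq : (fun z => S.partZ (V.image tlab) z ^ 2 - 1) =O[𝓝 (0 : ℂ)] fun z => z := by
    have h := hZdiff.isBigO_sub
    simp only [PlaqSystem.partZ_zero, one_pow, sub_zero] at h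
    exact h
  have hZinv : (fun z => (S.partZ (V.image tlab) z ^ 2)⁻¹) =O[𝓝 (0 : ℂ)] fun _ => (1 : ℂ) := by
    refine IsBigO.of_bound 4 ?_
    filter_upwards [hZnear] with z hz
    rw [norm_inv, norm_pow, norm_one, mul_one]
    have h4 : (1 / 4 : ℝ) ≤ ‖S.partZ (V.image tlab) z‖ ^ 2 := by nlinarith
    calc (‖S.partZ (V.image tlab) z‖ ^ 2)⁻¹ ≤ (1 / 4 : ℝ)⁻¹ := by
          exact inv_anti₀ (by norm_num) h4
      _ = 4 := by norm_num
  -- assemble: `κ - c z^m = (P - c z^m) Z⁻² - c z^m (Z² - 1) Z⁻²` near `0`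
  have hkey : ∀ᶠ z in 𝓝 (0 : ℂ), restTruncC ρ V f g z - c * z ^ m =
      ((1 / 2 : ℂ) * ∑ Q ∈ V.powerset.filter (fun Q => TJoins Q E₁ E₂), replicaTerm ρ f g Q z -
          c * z ^ m) * (S.partZ (V.image tlab) z ^ 2)⁻¹ -
        c * z ^ m * (S.partZ (V.image tlab) z ^ 2 - 1) * (S.partZ (V.image tlab) z ^ 2)⁻¹ := by
    filter_upwards [hZnear] with z hz
    have hZ0 : S.partZ (V.image tlab) z ≠ 0 := fun h => by rw [h, norm_zero] at hz; linarith
    have hZ2 : S.partZ (V.image tlab) z ^ 2 ≠ 0 := pow_ne_zero 2 hZ0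
    rw [← restTruncC_mul_partZ_sq_eq ρ hρ V hfm hgm hfb hgb hfE hgE hE hZ0]
    field_simp
    ring
  refine IsBigO.congr' ?_ (EventuallyEq.symm hkey) EventuallyEq.rfl
  have t1 : (fun z => ((1 / 2 : ℂ) * ∑ Q ∈ V.powerset.filter (fun Q => TJoins Q E₁ E₂),
      replicaTerm ρ f g Q z - c * z ^ m) * (S.partZ (V.image tlab) z ^ 2)⁻¹)
      =O[𝓝 (0 : ℂ)] fun z => z ^ (m + 1) := by
    simpa using hP.mul hZinv
  have t2 : (fun z => c * z ^ m * (S.partZ (V.image tlab) z ^ 2 - 1) *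
      (S.partZ (V.image tlab) z ^ 2)⁻¹) =O[𝓝 (0 : ℂ)] fun z => z ^ (m + 1) := by
    have hc : (fun z : ℂ => c * z ^ m) =O[𝓝 (0 : ℂ)] fun z => z ^ m :=
      (isBigO_const_mul_self c _ _)
    have h := (hc.mul hZsq).mul hZinv
    refine h.congr' EventuallyEq.rfl (Eventually.of_forall fun z => ?_)
    simp [pow_succ]
  exact t1.sub t2

end Replica

end DiagRPUnif

end

end Summit.QuantumFields.GaugeBoot
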